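import Literature.NumberTheory.LFunctions.DirichletLTruncationCertificatesOdd
import HarnessLib

/-!
# No real zero for the ODD real primitive characters of conductor `577 ≤ q ≤ 640`, in the kernel
# (truncation certificates with drift)

Topic `Literature/NumberTheory/LFunctions`; namespace `Literature.NumberTheory.LFunctions`
(private per-modulus work in `Literature.NumberTheory.LFunctions.OddTruncationIa`). THEOREMS only (no
definition, no named fact, no `sorry`): **`noRealZeroOdd_range_577_640`** — for every modulus
`577 ≤ q ≤ 640`, every primitive quadratic ODD `χ` mod `q` (imaginary quadratic fields of discriminant `−q`)
and every `σ ∈ (0, 1)`, `L(σ, χ) ≠ 0`.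

Per modulus (one bullet each, in the order of `interval_cases`): moduli without a primitive quadratic
character are dismissed (`q ≡ 2 (mod 4)`, `16 ∣ q`, `p² ∣ q` — MV Thm 9.13); the EVEN primitive quadratic
character is excluded by the parity test inside `LTruncationCert.good_odd_of_*`; the ODD one is certified by
**`LTruncationCert.certDriftOK v q K J P`** (`DirichletLTruncationCertificatesOdd.lean`): the truncation
`∑_{n ≤ Kq} χ(n) n^{−σ}` after `K` periods dominates the one-sided second-order tail bound `B⁻/(2(Kq+1)^{3/2})`
(`B⁻ = max_N (−U(N))⁺`; the drift `U(q) = q·h(−q) > 0` only helps) on each of `J` cells covering `[1/2, 1]`,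
and the functional equation reflects `(0, 1/2)` to `(1/2, 1)`.  20 certificates in this file (parameters
and margins in the docstrings; `K > 1` / `J > 16` only where the one-period truncation is too small at
`σ = 1/2`). [cite: Chua2005RealZeros, §2.2 ALGO 1]

## References

* K. S. Chua, *Real zeros of Dedekind zeta functions of real quadratic fields*, Math. Comp. 74 (2005)
  1457–1470, §2. [Chua2005RealZeros]
* M. Watkins, *Real zeros of real odd Dirichlet L-functions*, Math. Comp. 73 (2004) 415–423.
  [Watkins2004RealZeros]
* H. L. Montgomery, R. C. Vaughan, *Multiplicative Number Theory I*, CUP 2007, §9.3 Thm 9.13, §10.1.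
  [MontgomeryVaughan2007]
-/

namespace Literature.NumberTheory.LFunctions

namespace OddTruncationIa

open FeketePolyaKernel PrimitiveQuadratic LTruncationCert

/-- Conductor `≡ 2 (mod 4)`: no primitive character (private copy of the sweep-4 lemma).
[cite: MontgomeryVaughan2007, §9.3 Theorem 9.13] -/
private theorem absurd_of_mod_four_two {q : ℕ} [NeZero q] (hq : q % 4 = 2)
    {χ : DirichletCharacter ℂ q} (hprim : χ.IsPrimitive) : False := by
  obtain ⟨m, rfl⟩ : ∃ m, q = 2 * m := ⟨q / 2, by omega⟩
  haveI : NeZero m := ⟨by omega⟩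
  exact not_isPrimitive_two_mul (m := m) (Nat.odd_iff.mpr (by omega)) hprim

/-- Conductor divisible by `16`: no primitive quadratic character (private copy).
[cite: MontgomeryVaughan2007, §9.3 Theorem 9.13] -/
private theorem absurd_of_sixteen_dvd {q : ℕ} [NeZero q] (hq : q % 16 = 0) {χ : DirichletCharacter ℂ q}
    (hprim : χ.IsPrimitive) (hquad : χ.IsQuadratic) : False := by
  obtain ⟨k, m, hm, rfl⟩ := Nat.exists_eq_two_pow_mul_odd (NeZero.ne q)
  have hm2 := Nat.odd_iff.mp hm
  haveI : NeZero m := ⟨by omega⟩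
  have hk := le_three_of_level_two_pow_mul hm hprim hquad
  interval_cases k <;> norm_num at hq <;> omega

/-- Conductor with an odd square factor `p²`: no primitive quadratic character (private copy).
[cite: MontgomeryVaughan2007, §9.3 Theorem 9.13] -/
private theorem absurd_of_sq_dvd {q : ℕ} [NeZero q] {p : ℕ} (hp : p.Prime) (hp2 : p ≠ 2)
    (hpq : p * p ∣ q) {χ : DirichletCharacter ℂ q} (hprim : χ.IsPrimitive) (hquad : χ.IsQuadratic) :
    False := by
  obtain ⟨k, m, hm, rfl⟩ := Nat.exists_eq_two_pow_mul_odd (NeZero.ne q)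
  have hm2 := Nat.odd_iff.mp hm
  haveI : NeZero m := ⟨by omega⟩
  have hsq := squarefree_of_level_two_pow_mul hm hprim hquad
  have hp2' : Nat.Coprime p 2 := (Nat.coprime_primes hp Nat.prime_two).mpr hp2
  have hcop : Nat.Coprime (p * p) (2 ^ k) := Nat.Coprime.pow_right k (Nat.Coprime.mul_left hp2' hp2')
  have hpm : p * p ∣ m := hcop.dvd_of_dvd_mul_left hpq
  exact hp.one_lt.ne' (Nat.isUnit_iff.mp (hsq p hpm))

/-- `579`: the odd character `(·/579)` = `χ_{−579}` — drift certificate `K = 1`, `J = 16`, `P = 32` (`B⁻ = 0`, worst cell margin `0.862`). [cite: Chua2005RealZeros, §2.2 ALGO 1] -/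
private theorem goodOdd579 :
    ∀ χ : DirichletCharacter ℂ 579, χ.IsQuadratic → χ.IsPrimitive → χ.Odd →
      ∀ σ : ℝ, 0 < σ → σ < 1 → χ.LFunction σ ≠ 0 :=
  good_odd_of_odd (by decide) (by decide) 1 16 32 (by decide +kernel)

/-- `580 = 4·145`: the odd character `χ₋₄·(·/145)` = `χ_{−580}` — drift certificate `K = 1`, `J = 16`, `P = 32` (`B⁻ = 0`, worst cell margin `0.858`). [cite: Chua2005RealZeros, §2.2 ALGO 1] -/
private theorem goodOdd580 :
    ∀ χ : DirichletCharacter ℂ 580, χ.IsQuadratic → χ.IsPrimitive → χ.Odd →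
      ∀ σ : ℝ, 0 < σ → σ < 1 → χ.LFunction σ ≠ 0 :=
  good_odd_of_four (by decide) (by decide) 1 16 32 (by decide +kernel)

/-- `583`: the odd character `(·/583)` = `χ_{−583}` — drift certificate `K = 1`, `J = 16`, `P = 32` (`B⁻ = 99`, worst cell margin `0.831`). [cite: Chua2005RealZeros, §2.2 ALGO 1] -/
private theorem goodOdd583 :
    ∀ χ : DirichletCharacter ℂ 583, χ.IsQuadratic → χ.IsPrimitive → χ.Odd →
      ∀ σ : ℝ, 0 < σ → σ < 1 → χ.LFunction σ ≠ 0 :=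
  good_odd_of_odd (by decide) (by decide) 1 16 32 (by decide +kernel)

/-- `584 = 8·73`: the odd character `χ₋₈·(·/73)` = `χ_{−584}` — drift certificate `K = 1`, `J = 16`, `P = 32` (`B⁻ = 0`, worst cell margin `1.738`); the other primitive quadratic character mod `584` is even (parity test). [cite: Chua2005RealZeros, §2.2 ALGO 1] -/
private theorem goodOdd584 :
    ∀ χ : DirichletCharacter ℂ 584, χ.IsQuadratic → χ.IsPrimitive → χ.Odd →
      ∀ σ : ℝ, 0 < σ → σ < 1 → χ.LFunction σ ≠ 0 :=
  good_odd_of_eight (by decide) (by decide) 1 16 32 (by decide +kernel) (by decide +kernel)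

/-- `587`: the odd character `(·/587)` = `χ_{−587}` — drift certificate `K = 1`, `J = 16`, `P = 32` (`B⁻ = 0`, worst cell margin `0.741`). [cite: Chua2005RealZeros, §2.2 ALGO 1] -/
private theorem goodOdd587 :
    ∀ χ : DirichletCharacter ℂ 587, χ.IsQuadratic → χ.IsPrimitive → χ.Odd →
      ∀ σ : ℝ, 0 < σ → σ < 1 → χ.LFunction σ ≠ 0 :=
  good_odd_of_odd (by decide) (by decide) 1 16 32 (by decide +kernel)

/-- `591`: the odd character `(·/591)` = `χ_{−591}` — drift certificate `K = 1`, `J = 16`, `P = 32` (`B⁻ = 0`, worst cell margin `2.385`). [cite: Chua2005RealZeros, §2.2 ALGO 1] -/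
private theorem goodOdd591 :
    ∀ χ : DirichletCharacter ℂ 591, χ.IsQuadratic → χ.IsPrimitive → χ.Odd →
      ∀ σ : ℝ, 0 < σ → σ < 1 → χ.LFunction σ ≠ 0 :=
  good_odd_of_odd (by decide) (by decide) 1 16 32 (by decide +kernel)

/-- `595`: the odd character `(·/595)` = `χ_{−595}` — drift certificate `K = 1`, `J = 16`, `P = 32` (`B⁻ = 244`, worst cell margin `0.389`). [cite: Chua2005RealZeros, §2.2 ALGO 1] -/
private theorem goodOdd595 :
    ∀ χ : DirichletCharacter ℂ 595, χ.IsQuadratic → χ.IsPrimitive → χ.Odd →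
      ∀ σ : ℝ, 0 < σ → σ < 1 → χ.LFunction σ ≠ 0 :=
  good_odd_of_odd (by decide) (by decide) 1 16 32 (by decide +kernel)

/-- `596 = 4·149`: the odd character `χ₋₄·(·/149)` = `χ_{−596}` — drift certificate `K = 1`, `J = 16`, `P = 32` (`B⁻ = 0`, worst cell margin `1.498`). [cite: Chua2005RealZeros, §2.2 ALGO 1] -/
private theorem goodOdd596 :
    ∀ χ : DirichletCharacter ℂ 596, χ.IsQuadratic → χ.IsPrimitive → χ.Odd →
      ∀ σ : ℝ, 0 < σ → σ < 1 → χ.LFunction σ ≠ 0 :=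
  good_odd_of_four (by decide) (by decide) 1 16 32 (by decide +kernel)

/-- `599`: the odd character `(·/599)` = `χ_{−599}` — drift certificate `K = 1`, `J = 16`, `P = 32` (`B⁻ = 0`, worst cell margin `2.693`). [cite: Chua2005RealZeros, §2.2 ALGO 1] -/
private theorem goodOdd599 :
    ∀ χ : DirichletCharacter ℂ 599, χ.IsQuadratic → χ.IsPrimitive → χ.Odd →
      ∀ σ : ℝ, 0 < σ → σ < 1 → χ.LFunction σ ≠ 0 :=
  good_odd_of_odd (by decide) (by decide) 1 16 32 (by decide +kernel)

/-- `607`: the odd character `(·/607)` = `χ_{−607}` — drift certificate `K = 1`, `J = 16`, `P = 32` (`B⁻ = 0`, worst cell margin `1.371`). [cite: Chua2005RealZeros, §2.2 ALGO 1] -/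
private theorem goodOdd607 :
    ∀ χ : DirichletCharacter ℂ 607, χ.IsQuadratic → χ.IsPrimitive → χ.Odd →
      ∀ σ : ℝ, 0 < σ → σ < 1 → χ.LFunction σ ≠ 0 :=
  good_odd_of_odd (by decide) (by decide) 1 16 32 (by decide +kernel)

/-- `611`: the odd character `(·/611)` = `χ_{−611}` — drift certificate `K = 1`, `J = 16`, `P = 32` (`B⁻ = 0`, worst cell margin `1.052`). [cite: Chua2005RealZeros, §2.2 ALGO 1] -/
private theorem goodOdd611 :
    ∀ χ : DirichletCharacter ℂ 611, χ.IsQuadratic → χ.IsPrimitive → χ.Odd →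
      ∀ σ : ℝ, 0 < σ → σ < 1 → χ.LFunction σ ≠ 0 :=
  good_odd_of_odd (by decide) (by decide) 1 16 32 (by decide +kernel)

/-- `615`: the odd character `(·/615)` = `χ_{−615}` — drift certificate `K = 1`, `J = 16`, `P = 32` (`B⁻ = 0`, worst cell margin `2.117`). [cite: Chua2005RealZeros, §2.2 ALGO 1] -/
private theorem goodOdd615 :
    ∀ χ : DirichletCharacter ℂ 615, χ.IsQuadratic → χ.IsPrimitive → χ.Odd →
      ∀ σ : ℝ, 0 < σ → σ < 1 → χ.LFunction σ ≠ 0 :=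
  good_odd_of_odd (by decide) (by decide) 1 16 32 (by decide +kernel)

/-- `616 = 8·77`: the odd character `χ₋₈·(·/77)` = `χ_{−616}` — drift certificate `K = 1`, `J = 16`, `P = 32` (`B⁻ = 0`, worst cell margin `0.828`); the other primitive quadratic character mod `616` is even (parity test). [cite: Chua2005RealZeros, §2.2 ALGO 1] -/
private theorem goodOdd616 :
    ∀ χ : DirichletCharacter ℂ 616, χ.IsQuadratic → χ.IsPrimitive → χ.Odd →
      ∀ σ : ℝ, 0 < σ → σ < 1 → χ.LFunction σ ≠ 0 :=
  good_odd_of_eight (by decide) (by decide) 1 16 32 (by decide +kernel) (by decide +kernel)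

/-- `619`: the odd character `(·/619)` = `χ_{−619}` — drift certificate `K = 1`, `J = 16`, `P = 32` (`B⁻ = 123`, worst cell margin `0.506`). [cite: Chua2005RealZeros, §2.2 ALGO 1] -/
private theorem goodOdd619 :
    ∀ χ : DirichletCharacter ℂ 619, χ.IsQuadratic → χ.IsPrimitive → χ.Odd →
      ∀ σ : ℝ, 0 < σ → σ < 1 → χ.LFunction σ ≠ 0 :=
  good_odd_of_odd (by decide) (by decide) 1 16 32 (by decide +kernel)

/-- `623`: the odd character `(·/623)` = `χ_{−623}` — drift certificate `K = 1`, `J = 16`, `P = 32` (`B⁻ = 0`, worst cell margin `2.314`). [cite: Chua2005RealZeros, §2.2 ALGO 1] -/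
private theorem goodOdd623 :
    ∀ χ : DirichletCharacter ℂ 623, χ.IsQuadratic → χ.IsPrimitive → χ.Odd →
      ∀ σ : ℝ, 0 < σ → σ < 1 → χ.LFunction σ ≠ 0 :=
  good_odd_of_odd (by decide) (by decide) 1 16 32 (by decide +kernel)

/-- `627`: the odd character `(·/627)` = `χ_{−627}` — drift certificate `K = 1`, `J = 16`, `P = 32` (`B⁻ = 162`, worst cell margin `0.322`). [cite: Chua2005RealZeros, §2.2 ALGO 1] -/
private theorem goodOdd627 :
    ∀ χ : DirichletCharacter ℂ 627, χ.IsQuadratic → χ.IsPrimitive → χ.Odd →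
      ∀ σ : ℝ, 0 < σ → σ < 1 → χ.LFunction σ ≠ 0 :=
  good_odd_of_odd (by decide) (by decide) 1 16 32 (by decide +kernel)

/-- `628 = 4·157`: the odd character `χ₋₄·(·/157)` = `χ_{−628}` — drift certificate `K = 1`, `J = 16`, `P = 32` (`B⁻ = 112`, worst cell margin `0.603`). [cite: Chua2005RealZeros, §2.2 ALGO 1] -/
private theorem goodOdd628 :
    ∀ χ : DirichletCharacter ℂ 628, χ.IsQuadratic → χ.IsPrimitive → χ.Odd →
      ∀ σ : ℝ, 0 < σ → σ < 1 → χ.LFunction σ ≠ 0 :=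
  good_odd_of_four (by decide) (by decide) 1 16 32 (by decide +kernel)

/-- `631`: the odd character `(·/631)` = `χ_{−631}` — drift certificate `K = 1`, `J = 16`, `P = 32` (`B⁻ = 0`, worst cell margin `1.339`). [cite: Chua2005RealZeros, §2.2 ALGO 1] -/
private theorem goodOdd631 :
    ∀ χ : DirichletCharacter ℂ 631, χ.IsQuadratic → χ.IsPrimitive → χ.Odd →
      ∀ σ : ℝ, 0 < σ → σ < 1 → χ.LFunction σ ≠ 0 :=
  good_odd_of_odd (by decide) (by decide) 1 16 32 (by decide +kernel)

/-- `632 = 8·79`: the odd character `χ₈·(·/79)` = `χ_{−632}` — drift certificate `K = 1`, `J = 16`, `P = 32` (`B⁻ = 58`, worst cell margin `0.804`); the other primitive quadratic character mod `632` is even (parity test). [cite: Chua2005RealZeros, §2.2 ALGO 1] -/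
private theorem goodOdd632 :
    ∀ χ : DirichletCharacter ℂ 632, χ.IsQuadratic → χ.IsPrimitive → χ.Odd →
      ∀ σ : ℝ, 0 < σ → σ < 1 → χ.LFunction σ ≠ 0 :=
  good_odd_of_eight (by decide) (by decide) 1 16 32 (by decide +kernel) (by decide +kernel)

/-- `635`: the odd character `(·/635)` = `χ_{−635}` — drift certificate `K = 1`, `J = 16`, `P = 32` (`B⁻ = 0`, worst cell margin `1.031`). [cite: Chua2005RealZeros, §2.2 ALGO 1] -/
private theorem goodOdd635 :
    ∀ χ : DirichletCharacter ℂ 635, χ.IsQuadratic → χ.IsPrimitive → χ.Odd →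
      ∀ σ : ℝ, 0 < σ → σ < 1 → χ.LFunction σ ≠ 0 :=
  good_odd_of_odd (by decide) (by decide) 1 16 32 (by decide +kernel)

/-- **No real zero in `(0, 1)` for every odd real primitive character of conductor `577 ≤ q ≤ 640`**
(one bullet per modulus, in the order of `interval_cases`). [cite: Chua2005RealZeros, §2.2 ALGO 1] -/
theorem range_577_640 (q : ℕ) [NeZero q] (hlo : 576 < q) (hhi : q ≤ 640) :
    ∀ χ : DirichletCharacter ℂ q, χ.IsQuadratic → χ.IsPrimitive → χ.Odd →
      ∀ σ : ℝ, 0 < σ → σ < 1 → χ.LFunction σ ≠ 0 := by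
  interval_cases q
  · -- 577 ≡ 1 (mod 4): the primitive quadratic character (·/577) is even (parity test)
    exact good_odd_of_odd (by decide) (by decide) 1 16 32 (by decide +kernel)
  · -- 578 ≡ 2 (mod 4): no primitive character
    exact fun χ _ hprim _ ↦ (absurd_of_mod_four_two (by decide) hprim).elim
  · exact goodOdd579 -- certificate
  · exact goodOdd580 -- certificate
  · -- 581 ≡ 1 (mod 4): the primitive quadratic character (·/581) is even (parity test)
    exact good_odd_of_odd (by decide) (by decide) 1 16 32 (by decide +kernel)
  · -- 582 ≡ 2 (mod 4): no primitive character
    exact fun χ _ hprim _ ↦ (absurd_of_mod_four_two (by decide) hprim).elim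
  · exact goodOdd583 -- certificate
  · exact goodOdd584 -- certificate
  · -- 3² ∣ 585: no primitive quadratic character
    exact fun χ hquad hprim _ ↦
      (absurd_of_sq_dvd (p := 3) (by norm_num) (by decide) (by decide) hprim hquad).elim
  · -- 586 ≡ 2 (mod 4): no primitive character
    exact fun χ _ hprim _ ↦ (absurd_of_mod_four_two (by decide) hprim).elim
  · exact goodOdd587 -- certificate
  · -- 7² ∣ 588: no primitive quadratic character
    exact fun χ hquad hprim _ ↦
      (absurd_of_sq_dvd (p := 7) (by norm_num) (by decide) (by decide) hprim hquad).elim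
  · -- 589 ≡ 1 (mod 4): the primitive quadratic character (·/589) is even (parity test)
    exact good_odd_of_odd (by decide) (by decide) 1 16 32 (by decide +kernel)
  · -- 590 ≡ 2 (mod 4): no primitive character
    exact fun χ _ hprim _ ↦ (absurd_of_mod_four_two (by decide) hprim).elim
  · exact goodOdd591 -- certificate
  · -- 16 ∣ 592: no primitive quadratic character
    exact fun χ hquad hprim _ ↦ (absurd_of_sixteen_dvd (by decide) hprim hquad).elim
  · -- 593 ≡ 1 (mod 4): the primitive quadratic character (·/593) is even (parity test)
    exact good_odd_of_odd (by decide) (by decide) 1 16 32 (by decide +kernel)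
  · -- 594 ≡ 2 (mod 4): no primitive character
    exact fun χ _ hprim _ ↦ (absurd_of_mod_four_two (by decide) hprim).elim
  · exact goodOdd595 -- certificate
  · exact goodOdd596 -- certificate
  · -- 597 ≡ 1 (mod 4): the primitive quadratic character (·/597) is even (parity test)
    exact good_odd_of_odd (by decide) (by decide) 1 16 32 (by decide +kernel)
  · -- 598 ≡ 2 (mod 4): no primitive character
    exact fun χ _ hprim _ ↦ (absurd_of_mod_four_two (by decide) hprim).elim
  · exact goodOdd599 -- certificate
  · -- 5² ∣ 600: no primitive quadratic character
    exact fun χ hquad hprim _ ↦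
      (absurd_of_sq_dvd (p := 5) (by norm_num) (by decide) (by decide) hprim hquad).elim
  · -- 601 ≡ 1 (mod 4): the primitive quadratic character (·/601) is even (parity test)
    exact good_odd_of_odd (by decide) (by decide) 1 16 32 (by decide +kernel)
  · -- 602 ≡ 2 (mod 4): no primitive character
    exact fun χ _ hprim _ ↦ (absurd_of_mod_four_two (by decide) hprim).elim
  · -- 3² ∣ 603: no primitive quadratic character
    exact fun χ hquad hprim _ ↦
      (absurd_of_sq_dvd (p := 3) (by norm_num) (by decide) (by decide) hprim hquad).elim
  · -- 604 = 4·151, 151 ≡ 3 (mod 4): the primitive quadratic character is even (parity test)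
    exact good_odd_of_four (by decide) (by decide) 1 16 32 (by decide +kernel)
  · -- 11² ∣ 605: no primitive quadratic character
    exact fun χ hquad hprim _ ↦
      (absurd_of_sq_dvd (p := 11) (by norm_num) (by decide) (by decide) hprim hquad).elim
  · -- 606 ≡ 2 (mod 4): no primitive character
    exact fun χ _ hprim _ ↦ (absurd_of_mod_four_two (by decide) hprim).elim
  · exact goodOdd607 -- certificate
  · -- 16 ∣ 608: no primitive quadratic character
    exact fun χ hquad hprim _ ↦ (absurd_of_sixteen_dvd (by decide) hprim hquad).elim
  · -- 609 ≡ 1 (mod 4): the primitive quadratic character (·/609) is even (parity test)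
    exact good_odd_of_odd (by decide) (by decide) 1 16 32 (by decide +kernel)
  · -- 610 ≡ 2 (mod 4): no primitive character
    exact fun χ _ hprim _ ↦ (absurd_of_mod_four_two (by decide) hprim).elim
  · exact goodOdd611 -- certificate
  · -- 3² ∣ 612: no primitive quadratic character
    exact fun χ hquad hprim _ ↦
      (absurd_of_sq_dvd (p := 3) (by norm_num) (by decide) (by decide) hprim hquad).elim
  · -- 613 ≡ 1 (mod 4): the primitive quadratic character (·/613) is even (parity test)
    exact good_odd_of_odd (by decide) (by decide) 1 16 32 (by decide +kernel)
  · -- 614 ≡ 2 (mod 4): no primitive character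
    exact fun χ _ hprim _ ↦ (absurd_of_mod_four_two (by decide) hprim).elim
  · exact goodOdd615 -- certificate
  · exact goodOdd616 -- certificate
  · -- 617 ≡ 1 (mod 4): the primitive quadratic character (·/617) is even (parity test)
    exact good_odd_of_odd (by decide) (by decide) 1 16 32 (by decide +kernel)
  · -- 618 ≡ 2 (mod 4): no primitive character
    exact fun χ _ hprim _ ↦ (absurd_of_mod_four_two (by decide) hprim).elim
  · exact goodOdd619 -- certificate
  · -- 620 = 4·155, 155 ≡ 3 (mod 4): the primitive quadratic character is even (parity test)
    exact good_odd_of_four (by decide) (by decide) 1 16 32 (by decide +kernel)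
  · -- 3² ∣ 621: no primitive quadratic character
    exact fun χ hquad hprim _ ↦
      (absurd_of_sq_dvd (p := 3) (by norm_num) (by decide) (by decide) hprim hquad).elim
  · -- 622 ≡ 2 (mod 4): no primitive character
    exact fun χ _ hprim _ ↦ (absurd_of_mod_four_two (by decide) hprim).elim
  · exact goodOdd623 -- certificate
  · -- 16 ∣ 624: no primitive quadratic character
    exact fun χ hquad hprim _ ↦ (absurd_of_sixteen_dvd (by decide) hprim hquad).elim
  · -- 5² ∣ 625: no primitive quadratic character
    exact fun χ hquad hprim _ ↦
      (absurd_of_sq_dvd (p := 5) (by norm_num) (by decide) (by decide) hprim hquad).elim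
  · -- 626 ≡ 2 (mod 4): no primitive character
    exact fun χ _ hprim _ ↦ (absurd_of_mod_four_two (by decide) hprim).elim
  · exact goodOdd627 -- certificate
  · exact goodOdd628 -- certificate
  · -- 629 ≡ 1 (mod 4): the primitive quadratic character (·/629) is even (parity test)
    exact good_odd_of_odd (by decide) (by decide) 1 16 32 (by decide +kernel)
  · -- 630 ≡ 2 (mod 4): no primitive character
    exact fun χ _ hprim _ ↦ (absurd_of_mod_four_two (by decide) hprim).elim
  · exact goodOdd631 -- certificate
  · exact goodOdd632 -- certificate
  · -- 633 ≡ 1 (mod 4): the primitive quadratic character (·/633) is even (parity test)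
    exact good_odd_of_odd (by decide) (by decide) 1 16 32 (by decide +kernel)
  · -- 634 ≡ 2 (mod 4): no primitive character
    exact fun χ _ hprim _ ↦ (absurd_of_mod_four_two (by decide) hprim).elim
  · exact goodOdd635 -- certificate
  · -- 636 = 4·159, 159 ≡ 3 (mod 4): the primitive quadratic character is even (parity test)
    exact good_odd_of_four (by decide) (by decide) 1 16 32 (by decide +kernel)
  · -- 7² ∣ 637: no primitive quadratic character
    exact fun χ hquad hprim _ ↦
      (absurd_of_sq_dvd (p := 7) (by norm_num) (by decide) (by decide) hprim hquad).elim
  · -- 638 ≡ 2 (mod 4): no primitive character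
    exact fun χ _ hprim _ ↦ (absurd_of_mod_four_two (by decide) hprim).elim
  · -- 3² ∣ 639: no primitive quadratic character
    exact fun χ hquad hprim _ ↦
      (absurd_of_sq_dvd (p := 3) (by norm_num) (by decide) (by decide) hprim hquad).elim
  · -- 16 ∣ 640: no primitive quadratic character
    exact fun χ hquad hprim _ ↦ (absurd_of_sixteen_dvd (by decide) hprim hquad).elim

end OddTruncationIa

open OddTruncationIa in
/-- **Odd real primitive characters of conductor `577 ≤ q ≤ 640` have no real zero in `(0, 1)`.**
[cite: Watkins2004RealZeros, main theorem (d ≤ 3·10⁸, here re-proved in the kernel for this range)] -/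
theorem noRealZeroOdd_range_577_640 (q : ℕ) [NeZero q] (hlo : 576 < q) (hhi : q ≤ 640) :
    ∀ χ : DirichletCharacter ℂ q, χ.IsQuadratic → χ.IsPrimitive → χ.Odd →
      ∀ σ : ℝ, 0 < σ → σ < 1 → χ.LFunction σ ≠ 0 :=
  range_577_640 q hlo hhi

end Literature.NumberTheory.LFunctions
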